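import Mathlib
import HarnessLib
import HarnessLib.Audit
import Summits.Parity.Statement
import Summits.Parity.BatemanHorn.Theorems.IsogenyRedeiTypeIMainTerm
import Summits.Parity.BatemanHorn.Theorems.IsogenyRedeiLambdaToCount
import HarnessLib.Audit.Status.Attr

/-!
Route: GaussianFractions

DORMANT since 2026-08-24T20:59:43Z (reconciler: no traction for 7.1 d (last activity item-evidence-added at 2026-08-17T18:46:52Z); parked, not closed — `ledger route dormant route-Parity-GaussianFractions --off` to reactivate) — unstaffed, not closed; items shared with open routes are served there. `ledger route dormant <id> --off` reactivates.

# Route GaussianFractions — Möbius-tail frame for BatemanHorn; its n²+1 log-window slice is a signed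
root level X^(1/2+δ) whose engine is bilinear forms in root Kloosterman fractions over Z[i]

It suffices to show X = PolyMobiusTail, the MÖBIUS-TAIL frame shared verbatim with routes
PolynomialMobius / CyclotomicTower /
IsogenyRedei (target stmt-Parity-0870; theorem-grade glue TypeIMainTerm 0873, LambdaToCount 0874,
Assembly 0875): for every
Bateman–Horn system f there is η ∈ (0,1) with Σ_{n≤x} Σ_{d_i ∣ f_i(n), d₁⋯d_k > x^{1−η}} ∏ μ(d_i)
log d_i = o(x); the deciding theorem
`closes : PolyMobiusTail → TypeIMainTerm → LambdaToCount → BatemanHorn` is PROVED (Λ = −(μ·log)∗1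
bookkeeping, sorry-free, glue.lean).
Conforming re-filing of route KloostermanFractions (retired 2026-08-15 `not-a-thesis`: its assembly
stopped at HardyLittlewoodConjE),
realising card gaussian-kloosterman-fractions-window (spine; it also types C3 of card
unimodular-mobius-gm-continuity). The route exists
for ONE slice of X — k = 1, f = X²+1 — cut at the LOG-window Y = x(log x)^C: tail = WINDOW (moduli d
∈ (x^{1−η}, Y]: LogWindow, fed through
Harman's sieve by TypeIBelowHalf (in print), TypeIIPolylog (rank 4) and ONE new estimate, the signed
small-root level X^{1/2+δ} over moduli
with a marked prime, RootLevelBeyondHalf (rank 3), whose ENGINE is RootFractionsBound (rank 2):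
after Vaaler and CRT, e(hN/(pr)) =
e(hν_p r̄/p)·e(hν_r p̄/r) is a bilinear form in Kloosterman FRACTIONS with root numerators, ν_r ↔ a
primitive Gaussian integer of norm r,
|·| over the Gaussian prime outside — the Duke–Friedlander–Iwaniec 1997 / Bettin–Chandee shape at
the balanced point, nontrivial exactly
where large-sieve/kernel methods stop) + COFACTOR (d > Y: CofactorLog, rank 5, the parity atom,
named not attacked). SliceFromWindow is
the theorem-grade link LogWindow → CofactorLog → RootMainTerms → (the k = 1, f = X²+1 instance of
X); `closes` does not use the slice items.
Lean: `∀ (k : ℕ) (f : Fin k → Polynomial ℤ), Literature.NumberTheory.Sieve.IsBatemanHornSystem f → ∃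
η : ℝ, 0 < η ∧ η < 1 ∧ (fun x : ℕ => ∑ n ∈ Finset.Icc 1 x, ∑ d ∈ Fintype.piFinset (fun i => (((f
i).eval (n : ℤ)).toNat).divisors), if (x : ℝ) ^ (1 - η) < ∏ i, (d i : ℝ) then ∏ i,
((ArithmeticFunction.moebius (d i) : ℝ) * Real.log (d i)) else 0) =o[Filter.atTop] fun x : ℕ => (x :
ℝ)`

## Assembly
The deciding theorem is `closes (hTail : PolyMobiusTail) (hMain : TypeIMainTerm) (hCount :
LambdaToCount) : _root_.BatemanHorn`,
proved in glue.lean (lean check rc 0, axioms propext / Classical.choice / Quot.sound; the same term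
as PolynomialMobius.closes and
CyclotomicTower.closes): per coordinate ∏ Λ(f_i(n)) = (−1)^k Σ_{d ∈ ∏ divisors(f_i(n))} ∏ μ(d_i) log
d_i (Mathlib
ArithmeticFunction.sum_moebius_mul_log_eq, Finset.prod_univ_sum), the divisor sum split at ∏ d_i ≤
x^{1−η} (TypeIMainTerm: ∼ C·x) versus
> x^{1−η} (PolyMobiusTail: o(x)), IsEquivalent.add_isLittleO, then LambdaToCount; quantified over
(k, f) this is
Literature.NumberTheory.Sieve.BatemanHornConjecture = _root_.BatemanHorn. Its hypotheses are three
of the route's items and nothing else;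
the Assembly item below is literally this implication (shared with PolynomialMobius,
stmt-Parity-0875) and is proved by `closes`. IMPORT CONE:
no Literature fact is a hypothesis of any item (GM Thm 1.4/1.5 and DFI 1997 are named in prose
only); the only closed named fact reached is
BatemanHornConjecture itself, on the target side. How the slice items bear on the frame (the honest
link, typed as far as it goes):
RootFractionsBound →(FractionsToTypeI) RootLevelBeyondHalf →(WindowFromTypeInfo, with TypeIIPolylog,
TypeIBelowHalf) LogWindow
→(SliceFromWindow, with CofactorLog, RootMainTerms) the k = 1, f = X²+1 instance of PolyMobiusTail;
all other systems f stay with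
PolynomialMobius (its cruxes PolyMobiusAtom / PolyChowla) and the sibling slice routes.

Rationale: WHY THIS LINE. Under D-0027 §2.1 a BatemanHorn route must decide `_root_.BatemanHorn`; the only
typed reduction of the conjunct is the Λ = −(μ·log)∗1
split of PolynomialMobius (Type-I main term + Möbius tail, BombieriAsymptoticSieve1976,
BatemanHorn1962), so the frame is imported verbatim
and this route's mathematics is the n²+1 slice of the tail, where it cuts at the log-window: there
the modulus side needs exactly ONE estimate
beyond print — Type I for the small-root counts a_k(X) = #{ℓ ≤ X : k ∣ ℓ²+1} with the |·|-divisor at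
X^{1/2}·(quasi-power), i.e. past the
point d = √k where Hooley / Deshouillers–Iwaniec / de la Bretèche–Drappeau (level x^{(32−7α)/50} =
x^{1/2} at α = 1, Merikoski2022 Prop. 3)
and Grimmelt–Merikoski (D ≤ X^{1/2−o(1)}, arXiv:2505.00493 Thm 1.4 / Cor. 7.1; tree:
`grimmeltMerikoski2025_thm14_restricted`) stop for the
reason the large sieve stops at Q = √x (Literature.Barriers.Parity.LargeSieveLevelHalf), and which
contains Merikoski's open Type-I₂ problem
at M = N = √P (Merikoski2022 §4). The imported area is the Kloosterman-FRACTION technology —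
counting/amplification inequalities for
Σ α_m β_n e(a m̄/n) that save a power at M = N with arbitrary coefficients
(DukeFriedlanderIwaniec1997, tree fact
`DukeFriedlanderIwaniec1997_bilinearKloostermanFractions`; BettinChandee2018; Wright
arXiv:2604.25177; Shparlinski doi:10.1007/s00013-021-01623-y),
already used as an 'R* on average' substitute to push levels of distribution past x^{1/2} WITH
absolute values (FouvryRadziwill2022
Cor. 1.1: x^{1/2+1/66}); the dictionary is exact — roots N mod pr ↔ (ν_p, primitive ideal 𝔯 ⊂ ℤ[i])
(Gauss/DukeFriedlanderIwaniec1995),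
e(hN/pr) = e(hν_p r̄/p)e(hν_r p̄/r) — and the one new feature, numerators entangled with the roots,
is isolated in the rank-2 crux with
a one-page falsification test. No other BatemanHorn route carries a beyond-√X modulus-side statement
(IsogenyRedei: degree-2 slice,
COFACTOR side; CyclotomicTower: X⁴+1 prime slice; PolynomialMobius: no engine); the two
negatives-index entries are unrelated.

RANKED CRUXES. #0 PolyMobiusTail (target) — X_PM of route PolynomialMobius (stmt-Parity-0870),
re-wanted verbatim as this route's frame: for every Bateman–Horn system f = (f₁,…,f_k) there is η ∈
(0,1) with Σ_{n≤x} Σ_{d_i ∣ f_i(n), d₁⋯d_k > x^{1−η}} ∏_i μ(d_i) log d_i = o(x). With TypeIMainTerm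
and LambdaToCount it gives _root_.BatemanHorn (`closes`). This route attacks its k = 1, f = X²+1
slice, cut at the log-window (SliceFromWindow). (why it might fail: = BatemanHorn in Λ-form modulo
theorem-grade glue (Bombieri's indeterminacy: no Type-I level < 1 decides it); false iff BH fails
for some system — which happens verbatim over 𝔽_q[u] for inseparable f (Conrad–Conrad–Gross); this
route reaches one slice only.) [BombieriAsymptoticSieve1976, arXiv:2008.09905,
Literature.Barriers.Parity.FunctionFieldMobiusBias,
Literature.Barriers.Parity.FordFixedLevelBarrier]
#2 RootFractionsBound (crux) — ENGINE (card K1, typed over ℤ; re-wants stmt-Parity-6765). ∃ δ > 0: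
for X ≥ X₀, K ∈ [X^{1−δ}, X^{1+δ}], P ∈ [X^{1/2−δ}, X^{1/2+δ}], K ≤ K' ≤ 2K, 0 ≤ T ≤ X, 1 ≤ t ≤ X^δ,
0 < |h| ≤ X^δ: Σ_{p ∈ (P,2P] prime} Σ_{a mod p, a² ≡ −1} | Σ_{r : t ∣ r, K < pr ≤ K'} Σ_{N mod pr :
N² ≡ −1 (pr), N ≡ a (p)} e(h(N − T)/(pr)) | ≤ K·X^{−δ} (trivial ≍ K/(t log P)). By CRT and
reciprocity the phase is e(hν_p r̄/p)·e(hν_r p̄/r) up to the smooth twist e(−hT/(pr)): a bilinear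
form in Kloosterman FRACTIONS with root numerators, outer variable = Gaussian prime π (p = Nπ, a =
ι_π(i)), inner variable = primitive Gaussian integer of norm r, |·| outside = arbitrary coefficients
on π — the DFI-1997/Bettin–Chandee shape at the balanced point r ≍ K/P ≍ P. Implies
RootLevelBeyondHalf (support FractionsToTypeI, Vaaler; coupling δ_RLBH ≤ δ/3). [difficulty:
open-problem] (why it might fail: The numerator is entangled with BOTH variables (h(ν_r − ν_p)p̄/r):
DFI97/BC need a free numerator (tree fact DukeFriedlanderIwaniec1997_bilinearKloostermanFractions
has fixed k), graph-supported numerators can kill all cancellation (a_m = m gives e(1/n)), and the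
ℤ[i] lattice count may lose R^(1/2).) [DukeFriedlanderIwaniec1997, BettinChandee2018,
FouvryRadziwill2022, arXiv:2604.25177, doi:10.1007/s00013-021-01623-y, DukeFriedlanderIwaniec1995]
#3 RootLevelBeyondHalf (crux) — INTERFACE (card C3 of unimodular-mobius-gm-continuity with power
room, signed over primes; re-wants stmt-Parity-6766). ∃ δ > 0: for X ≥ X₀, K ∈ [X^{1−δ}, X^{1+δ}], K
≤ K' ≤ 2K, P ∈ [X^{1/2−δ}, X^{1/2+δ}], P ≤ P' ≤ 2P, 1 ≤ t ≤ X^δ: | Σ_{p ∈ (P,P'] prime} Σ_{k ∈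
(K,K'], pt ∣ k} ( #{1 ≤ ℓ ≤ X : k ∣ ℓ²+1} − X ρ(k)/k ) | ≤ X^{1−δ}, ρ = polyRootCountMod(X²+1)
(trivial ≍ X/log X). Signed level X^{1/2+δ} for the small-root sequence over moduli with a marked
prime ≈ √K — the input the Harman glue needs for the balanced semiprimes of the window. Print stops
at |·|-divisor ≤ X^{1/2−o(1)}; refuter numerics (kit j000211/j000220, X ≤ 10⁷): square-root
cancellation, no plateau. [deps: RootFractionsBound] [difficulty: open-problem] (why it might fail:
n²+1 analogue of 'primes to prime moduli beyond √x with fixed residue' (open; BFI reach x^(1/2+o(1))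
with |·|); dlBD/GM stop at X^(1/2−o(1)) and by Vaughan it contains Merikoski's Type-I₂ at M = N =
√P, 'open even for D₂ = 1'; a power saving may simply be false at P = X^(1/2+δ).) [arXiv:2505.00493,
Merikoski2022, DeshouillersIwaniec1982, BombieriFriedlanderIwaniecActa1986,
FordMaynard2024PrimeSieves, DukeFriedlanderIwaniec1995]
#4 TypeIIPolylog (crux) — Grimmelt–Merikoski's Type II (arXiv:2505.00493 Thm 1.5, h = a = 1; tree
fact `grimmeltMerikoski2025_thm15`) with POLYLOG losses down to tiny N (re-wants stmt-Parity-6767):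
∀ A, C > 0 ∃ B, X₀: for X ≥ X₀, K ∈ [X(log X)^{−C}, X(log X)^{C}], exp((log X)^{2/3}) ≤ N ≤
X^{1/3}(log X)^{−B}, MN = K, real 1-bounded α, β supported on squarefrees: | Σ_{m ~ M} Σ_{n ~ N} α_m
β_n ( #{ℓ ≤ X : mn ∣ ℓ²+1} − Xρ(mn)/(mn) ) | ≤ X(log X)^{−A}. GM give ≺≺ M^{1/2}X^{1/2} +
M^{1/4}NX^{1/2}(1 + X/(M^{1/2}N²))^θ, saving min(N^{1/2}, (X/N³)^c) up to X^{o(1)}; the crux is the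
loss (log X)^{O(1)} (deltas vs print: polylog loss, MN < X sharp, N down to exp((log X)^{2/3}) — a
load-bearing floor: β = δ_{n₀} gives ≍ K/N). [difficulty: L] (why it might fail: GM absorb the
modulus average by a POINTWISE divisor bound (their ≺≺ hides exp(O(log X/log log X))); polylog
losses need divisor sums on average inside the automorphic-kernel count, uniformly for N as small as
exp((log X)^(2/3)) — may fail structurally.) [arXiv:2505.00493, Merikoski2022,
DukeFriedlanderIwaniec1995]
#5 CofactorLog (crux) — The parity atom of the slice, correctly quantified (re-wants
stmt-Parity-6768; C, δ coupled to nothing else, every admissible C leaves inner sums of length ≥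
(log x)^C ρ(e); random model needs C > 2 + 2δ): ∃ C ≥ 0, δ > 0, x₀: for x ≥ x₀, Σ_{e ≤ 2x(log
x)^{−C}} | Σ_{n ≤ x, e ∣ n²+1, n²+1 > e·x(log x)^C} μ((n²+1)/e) | ≤ x(log x)^{−1−δ} (trivial ≍ x log
x). Covers every divisor d = (n²+1)/e above the log-window Y = x(log x)^C; its e = 1 term alone is
Chowla for n²+1. Named, not attacked here (cofactor-side routes: IsogenyRedei, SelmerPencil).
[difficulty: open-problem] (why it might fail: It is the parity atom: μ of the cofactor (n²+1)/e ≥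
x(log x)^C along ρ(e) root classes with a (log x)^(2+δ) saving — Chowla-type for an irreducible
quadratic; no Type-I/II mechanism exists (FordMaynardLowLevel, c = 1/2); only F_q[t] analogues are
known.) [SawinShusterman2022, Harman2007, FordMaynard2024PrimeSieves,
Literature.Barriers.Parity.SelbergParityBarrier, Literature.Barriers.Parity.FordMaynardLowLevel]
#9 TypeIMainTerm (support) — shared verbatim with PolynomialMobius (stmt-Parity-0873): the Type-I
main term — for every BH system f and η ∈ (0,1) there is C > 0 with HasBatemanHornConst f C and
(−1)^k Σ_{n≤x} Σ_{d_i ∣ f_i(n), ∏d_i ≤ x^{1−η}} ∏ μ(d_i) log d_i ∼ C·x (elementary count with period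
lcm(d) ≤ x^{1−η} + log-weighted singular series → C(f) by the prime ideal theorem). Theorem-grade,
provable with effort. [difficulty: L] [BatemanHorn1962, BombieriAsymptoticSieve1976]
#9 LambdaToCount (support) — shared verbatim with PolynomialMobius (stmt-Parity-0874): from Σ_{n≤x}
∏Λ(f_i(n)) ∼ C·x with HasBatemanHornConst f C to BatemanHornAsymptotic f (partial summation; proper
prime-power values negligible). Theorem-grade. [difficulty: L] [BatemanHorn1962,
IwaniecKowalski2004]
#9 TypeIBelowHalf (support) — Type I BELOW the diagonal, sharp form of Grimmelt–Merikoski Thm 1.4 /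
Cor. 7.1 at h = a = 1 (re-wants stmt-Parity-6769; in tree as the smooth named fact
`grimmeltMerikoski2025_thm14_restricted` with the ℓ²+1 corollary `_restricted_one`; the printed K ≤
X² range is refuted in tree, the restricted range covers K ≍ X): ∀ ε > 0 ∃ δ > 0, X₀: for X ≥ X₀, K
∈ [X^{1−δ}, X^{1+δ}], K ≤ K' ≤ 2K, 1 ≤ D ≤ X^{1/2−ε}: Σ_{d ≤ D} | Σ_{k ∈ (K,K'], d ∣ k} ( #{ℓ ≤ X :
k ∣ ℓ²+1} − Xρ(k)/k ) | ≤ X^{1−δ}. Known modulo unsmoothing (power room); NOT taken as a hypothesis,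
so the route's cone has no unproved fact; used by the glue for the tiny Legendre moduli and marked
primes q ≤ X^{1/2−ε}. [difficulty: L] [arXiv:2505.00493, Merikoski2022, DeshouillersIwaniec1982,
Hooley1976]
#9 RootMainTerms (support) — PNT(ℚ(i))-strength main-term inputs (re-wants stmt-Parity-6770), ρ =
polyRootCountMod(X²+1): ∀ A > 0 ∃ C: for y ≥ 2, |Σ_{d ≤ y} μ(d)ρ(d)/d| ≤ C(log y)^{−A} and |Σ_{d ≤
y} μ(d)ρ(d) log d/d + hardyLittlewoodEConst| ≤ C(log y)^{−A} (Σ_d μ(d)ρ(d)d^{−s} = G(s)/ζ(s), G(1) =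
hardyLittlewoodEConst, sign checked numerically: Σ → −1.37; μρ = μ·(1∗χ₋₄) on odd squarefrees, so
both follow from SiegelWalfiszMoebius_holds by the hyperbola method + Abel). Provable now
(laborious). [difficulty: provable-now] [MontgomeryVaughan2007, BatemanHorn1962,
Literature.NumberTheory.LFunctions.SiegelWalfiszMoebius_holds,
Literature.NumberTheory.Sieve.tendsto_hardyLittlewoodE_partial_holds]
#9 LogWindow (support) — the LOG-window Möbius-on-moduli statement (re-wants stmt-Parity-6771), all
heights, sub-dyadic: ∀ C > 0 ∃ x₀: for x ≥ x₀, x(log x)^{−C} ≤ D ≤ x(log x)^{C}, D ≤ D' ≤ 2D: |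
Σ_{D<d≤D'} μ(d)( #{n ≤ x : d ∣ n²+1} − xρ(d)/d ) | ≤ x(log x)^{−3/2}. Exponent 3/2 (not all A): the
Harman boundary slivers at X^{1/3±o(1)} cost x(log log x)²/(log x)², and 3/2 suffices for the slice
because the window has O(log log x) sub-dyadic blocks against the weight log d. Output of
WindowFromTypeInfo; refuter numerics within 1σ of the random model for D ∈ [x/64, 8x], x ≤ 10⁶.
[difficulty: L] [FordMaynard2024PrimeSieves, arXiv:2505.00493, Harman2007,
DukeFriedlanderIwaniec1995]
#9 FractionsToTypeI (support) — dual ⇒ primal (card K2; re-wants stmt-Parity-6772):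
RootFractionsBound → RootLevelBeyondHalf. #{1 ≤ ℓ ≤ X : ℓ ≡ N (k)} − X/k = ψ(−N/k) − ψ((X−N)/k)
exactly, Vaaler's trigonometric majorant/minorant of the sawtooth at H = X^{2δ'} (zero-frequency
error ≪ K/(tH log P)), frequencies e(h(N−T)/k) for T ∈ {0, X} = the T-twist of the crux, split by
the root a = N mod p and the triangle inequality; sub-dyadic (P,P'] ⊂ (P,2P] is free by positivity
of the (p,a)-summands; coupling δ' ≤ δ_RFB/3 (refuter g41-23). Vaaler/Erdős–Turán is not in tree
(Literature gap). [difficulty: L] [Vaaler1985, MontgomeryVaughan2007, Hooley1976]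
#9 WindowFromTypeInfo (support) — Harman-sieve glue on the log-window (card K4; re-wants
stmt-Parity-6773): RootLevelBeyondHalf → TypeIIPolylog → TypeIBelowHalf → LogWindow. Work with the
DIFFERENCE sequence r_d(x) (no main terms to evaluate); decompose squarefree d ~ D ≍ x(log x)^{±C}
by factorisation type with z = exp((log X)^{2/3}): a sub-product in [z, X^{1/3}(log X)^{−B}] ⇒ Type
II (coupling P⁻(m) ≥ q removed on (log X)^{A+1} short q-ranges); else d = s·(≤ 3 primes >
X^{1/3}(log)^{−B}), s < z: one prime ⇒ Legendre to z truncated by Rankin at level z^L ≤ X^δ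
(TypeIBelowHalf) + Buchstab primes in the Type-II range; two primes q ≤ m' ⇒ modulus s·e·q·m', q ∈
[X^{1/2−δ}, √(2x)(log x)^{C/2}]: RootLevelBeyondHalf (signed over prime q, t = s·e ≤ X^δ, sub-dyadic
ranges decouple m' ≥ q) or TypeIBelowHalf when q ≤ X^{1/2−ε}; three primes ≍ X^{1/3} ⇒ boundary
sliver of mass ≪ x(log log x)²/(log x)² < x(log x)^{−3/2}. Divisor-boundedness of a_k is what makes
(½, 0⁺, ⅓) work (FordMaynard2024PrimeSieves Thm 2.5). No Harman framework in tree: the route's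
largest Lean debt. [difficulty: XL] [Harman2007, FordMaynard2024PrimeSieves,
DukeFriedlanderIwaniec1995, arXiv:2505.00493]
#9 SliceFromWindow (support) — NEW glue replacing the retired route's HLEFromLogWindow: LogWindow →
CofactorLog → RootMainTerms → (the k = 1, f = X²+1 instance of PolyMobiusTail, up to Fin 1
bookkeeping: ∃ η ∈ (0,1), Σ_{n≤x} Σ_{d ∣ n²+1, d > x^{1−η}} μ(d) log d = o(x)). Proof (η = 1/2, Y =
x(log x)^C with C from CofactorLog): Σ_{d∣m, d>w} μ(d) log d = −log m·Σ_{d∣m, d≤w} μ(d) − Σ_{d∣m,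
d>w} μ(d) log(m/d); first piece o(x) by RootMainTerms at level x^{1/2}; in the second, d ∈ (x^{1/2},
x(log x)^{−2}] is trivial (errors ≪ x/log x, main terms by RootMainTerms), d ∈ [x(log x)^{−2}, Y] is
LogWindow (Abel in n against log(n²+1) over heights t ≥ x(log x)^{−3}, trivial O(t log t) below;
Abel in d on O(log log x) sub-dyadic blocks: O(x log log x (log x)^{−1/2})), d > Y is ≤ log x ·
CofactorLog = O(x(log x)^{−δ}). [difficulty: M] [BatemanHorn1962, BombieriAsymptoticSieve1976,
MontgomeryVaughan2007, Hooley1976]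

TWO-LAYER PLAN. Foreseen glued splits (none filed now; k ≤ 3, depth 1). RootFractionsBound ⇐
ZDiagonalForm (the un-entangled ℤ-model Σ_p |Σ_r β(r) Σ_{ν_r}
e(hν_r p̄/r)|: DFI97 counting transplanted to denominators 𝔯 ⊂ ℤ[i] — Cauchy in the denominator,
incomplete Kloosterman/Ramanujan sums, a
2-dimensional lattice count) → EntangledNumerator (absorbing e(hν_p r̄/p): (π, u_π) as a point of
the SL₂ variety Im(π u) = 1, the third
variable of a TRILINEAR form as in Bettin–Chandee's Σ_a ν_a) → RootFractionsBound. TypeIIPolylog ⇐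
(GM kernel bound with divisor sums on
average) → (short-N dispersion, N ≤ X^ε, + unsmoothing) → TypeIIPolylog. WindowFromTypeInfo ⇐
(Harman decomposition lemma for a difference
sequence at (½, 0⁺, ⅓)) → (sliver-mass lemma) → WindowFromTypeInfo. The frame X is NOT decomposed
here (PolynomialMobius' business);
SliceFromWindow is the typed statement of how this route's items re-enter it.

KILL CRITERIA. PolyMobiusTail refuted (some BH system with a biased Möbius tail) while TypeIMainTerm
∧ LambdaToCount are proved ⇒ ¬BatemanHorn: file it
(shared kill with PolynomialMobius / CyclotomicTower / IsogenyRedei). RootLevelBeyondHalf refuted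
(an Ω(X^{1−o(1)}) bias of the signed
marked-prime discrepancy, or a numerical plateau |S| ≍ X/log X beyond P = √X — kit j000211 / j000220
showed square-root cancellation up to
X = 10⁷) closes the route `refuted:RootLevelBeyondHalf` and refutes RootFractionsBound with it
(FractionsToTypeI). RootFractionsBound refuted
ALONE (DFI97/BC counting provably degenerate for root numerators while the signed sum still cancels)
⇒ pivot: restate rank 2 for another
engine (trilinear form with the SL₂ point (π, u_π) as free third variable; spectral large sieve over
ℚ(i)), keep the interface. TypeIIPolylog
refuted (X^{o(1)} loss structural below N = X^ε) ⇒ pivot to a power cut z = X^{δ₀} and an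
o(x)-quality window, which no longer reaches the
slice ⇒ close `exhausted` with that census unless a Siegel–Walfisz-type input for roots appears.
CofactorLog refuted (a μ-bias of large
cofactors of n²+1 on average over e) kills every Λ = μ∗log slice for n²+1 (this one,
IsogenyRedei's): report, close. LogWindow or the slice
proved elsewhere moots ranks 2–4 (rank 3 stays wanted as C3); PolyMobiusTail proved elsewhere ⇒
BatemanHorn by `closes`, route moot.

NOT DECOMPOSED YET. The ℤ[i] lattice-point/spacing lemma of the DFI97 transplant and the entangled
numerator (children of rank 2, above); the ℤ-model test
with root-type numerators (the card's K3 — a refuter task, see Cheapest falsifier); the power window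
of (W) up to x^{1+η} (would
need level X^{1/2+η/2} AND Type II beyond X^{(1−η)/3}: deliberately replaced by the log-window +
CofactorLog cut); Type I with |·| over ALL
moduli q ≤ X^{1/2+δ} (EH-shaped, stronger than needed, not filed); the unsmoothing lemma GM-smooth →
sharp (inside TypeIBelowHalf /
WindowFromTypeInfo); Vaaler's extremal polynomials (inside FractionsToTypeI); general quadratic f
(orders of ℚ(√−D), class number > 1),
deg ≥ 3 (CyclotomicTower), k ≥ 2 systems and the uniformity over systems that BatemanHornConjecture
proper needs — all left in X =
PolyMobiusTail, which is not decomposed here; the Fin 1 bookkeeping between SliceFromWindow's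
conclusion and the literal k = 1 instance of X.

CHEAPEST FALSIFIER. (1) DONE by refuters on the retired items (evidence on stmt-Parity-6766/6771;
kit jobs j000211, j000220): the marked-prime discrepancy
S(X,P) = Σ_{p~P} Σ_{k~X, p∣k} (a_k(X) − Xρ(k)/k), X ≤ 10⁷, P = √X·2^j: |S| ≲ 0.5·√count, no plateau
across the diagonal; the window sums
Σ_{d~D} μ(d) r_d(x) within 1σ of the random model for D ∈ [x/64, 8x] — no kill signal for rank 3 /
LogWindow. (2) NEXT, the ENGINE test (kit,
minutes): B(P,R,h) = Σ_{p~P} Σ_{a²≡−1 (p)} |Σ_{r~R} Σ_{N²≡−1 (pr), N≡a (p)} e(hN/(pr))| for P = R ∈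
{10³,…,3·10⁴}, h ≤ 3: rank 2 predicts
B ≤ (PR)^{1−δ} (random ≍ P√R/log P); a plateau B ≍ PR/log P kills rank 2, strong evidence against
rank 3. (3) Theory, one page:
does the Bettin–Chandee bound degenerate for ν supported on the graph a = ν_m? Yes for a = m
(e(1/n)); for roots the pure-ν_p part is an
incomplete Kloosterman sum mod p of length ≍ p (Weil: fine); decisive is the mixed phase e(h(ν_r −
ν_p)p̄/r) — if it provably defeats every
Cauchy-in-the-denominator count, rank 2 is dead as an ENGINE (pivot). (4) Lookup (negative): no
marked-prime level beyond x^{1/2} in GM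
(p.4: 'precisely D ≤ X^{1/2−o(1)}') or Merikoski2022 §4 ('Type I₂ at M = N = √P … open even for D₂ =
1').

NUMBERS. Type-I level for the small-root sequence at K ≍ X: D ≤ X^{1/2−o(1)} (arXiv:2505.00493 Thm
1.4 / Cor. 7.1: ≺≺ D X^{1/2}(1+X/D²)^θ, θ = 7/64; the
printed K ≤ X² range is refuted in tree, `grimmeltMerikoski2025_thm14_false`, the restricted K ≤
D·X^{1+δ} form stands; Merikoski2022 Prop. 3
= dlBD: x^{(32−7α)/50−η} = x^{1/2−η} at α = 1; DI 1982: x^{1−ε}P^{−1/2}; Hooley: x^{1−ε}P^{−3/4}).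
Type II at MN ≍ X: X^{2η} ≤ N ≤ X^{1/3−4η/3},
saving X^{−(1−2θ)η} (arXiv:2505.00493 Cor. 7.2); N < x^{(57−32α)/96} (Merikoski2022 Prop. 4(i)); N <
M^{1/2} for β on primes (DukeFriedlanderIwaniec1995
Prop. 2). Ford–Maynard: (½,0,ν), ⅓ ≤ ν < ½ is a continuity point for divisor-bounded sequences (Thm
2.5), degenerate for general ones (Thm 2.4).
Kloosterman fractions: DFI97 Thm 2 (tree fact, twisted form) ≤
K_ε‖α‖‖β‖(1+|X|/MN)(|k|+MN)^{3/8}(M+N)^{11/48+ε}, nontrivial at M = N;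
Bettin–Chandee at A = 1, M = N saves N^{−1/20}; Fouvry–Radziwiłł Cor. 1.1: level x^{1/2+1/66−ε} with
|·|. This route asks: δ > 0 arbitrary but
fixed at P = X^{1/2+δ}; window exponent 3/2; Type-II floor exp((log X)^{2/3}); CofactorLog needs C >
2 + 2δ under the random model. Items at
open: 14 (1 target, 4 cruxes, 8 supports, 1 assembly): 4 shared verbatim with PolynomialMobius
(0870/0873/0874/0875), 9 re-wanted verbatim from
the retired KloostermanFractions (6765–6773: audited by three refuters and a grounder, 0 refuted), 1
new (SliceFromWindow).

DEFINITION REQUESTS. None: everything is typed with Mathlib +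
`Literature.NumberTheory.Sieve.polyRootCountMod` / `hardyLittlewoodEConst` / `IsBatemanHornSystem` /
`HasBatemanHornConst` / `BatemanHornAsymptotic`. In-tree named facts relevant to provers (prose
only, never hypotheses):
`grimmeltMerikoski2025_thm14_restricted(_one)`, `grimmeltMerikoski2025_thm15(_one)`,
`DukeFriedlanderIwaniec1997_bilinearKloostermanFractions`,
`SiegelWalfiszMoebius_holds`. Literature gaps to be vendored by whoever proves the glue (not filed
now): Vaaler 1985 / Erdős–Turán
(FractionsToTypeI); Σ_{n≤t} τ(n²+1) ≪ t log² t (SliceFromWindow); an unsmoothing lemma for GM Type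
I; Bettin–Chandee 2018 Thm 1 (children of rank 2).

Novelty: Searches (2026-08-15, this session): `lit search --source zbmath "Kloosterman fractions"` (25 rows:
DukeFriedlanderIwaniec1997, BettinChandee2018
= arXiv:1502.00769, Shparlinski 2021 doi:10.1007/s00013-021-01623-y 'Bounds of trilinear sums with
Kloosterman fractions', FouvryRadziwill2022 =
arXiv:1811.08672, Fouvry–Radziwiłł arXiv:1812.00562, BCR arXiv:1411.7764, Bui–Pratt–Robles–Zaharescu
arXiv:1808.10803, Irving arXiv:1301.6372 —
none over ℤ[i], none with root-valued numerators, none aimed at roots of ν²+1); `lit galaxy search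
"Kloosterman fractions" --star all` (9 rows:
Surveys in Number Theory 2003, Greaves–Harman–Huxley LMS 237, Young 2208.03358, Assing–Blomer–Li
2005.13915, BCR, FI X²+Y⁴, Bagshaw–Kerr
2304.05009 — none on quadratic roots); `lit search --hybrid "Kloosterman fractions bilinear forms
level of distribution beyond 1/2"` (vector
leg only, 12 noise rows; FTS/searchd rc 75 this session); `lit read arXiv:1908.08816` pp.3,5,17
(Merikoski: DI/dlBD levels, Props 3–4, §4
'Type I₂ … open even for D₂ = 1', 'asymptotic for S(x,P) only for P = x^{1+o(1)}'); `lit read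
arXiv:2505.00493` pp.3–4,16 (Thms 1.4–1.5, Cor.
7.1–7.2, 'precisely D ≤ X^{1/2−o(1)} and N ≤ X^{1/4−o(1)}'); `lean search`
(grimmeltMerikoski2025_thm14/15 + _false/_restricted,
DukeFriedlanderIwaniec1997_bilinearKloostermanFractions); `ledger negatives --problem Parity` (2,
unrelated); the 22 route files of the sub
(8 open) and the refuter/grounder notes on stmt-Parity-6765…6773; plus the card's audited sear  [refs: 10.1007/s00013-021-01623-y, 1502.00769, 1811.08672, 1812.00562, 1411.7764, 1808.10803, 1301.6372, 1908.08816, 2505.00493, doi:10.1007/s00013-021-01623-y, DukeFriedlanderIwaniec1997, BettinChandee2018, FouvryRadziwill2022, DukeFriedlanderIwaniec1995, GrimmeltMerikoski2025]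

Barriers (technique_class: kloosterman-fractions bilinear-forms dispersion small-roots): - technique_class: kloosterman-fractions bilinear-forms dispersion small-roots
- Literature.Barriers.Parity.SelbergParityBarrier: APPLIES to the frame and is not evaded —
PolyMobiusTail is the whole parity content of BatemanHorn (Bombieri's indeterminacy), carried as the
target exactly as in PolynomialMobius; inside the slice it is confined to CofactorLog (named atom,
rank 5); ranks 2–4 and LogWindow are Möbius-on-MODULI statements for the positive-density,
divisor-bounded sequence a_k(X), where Type I/II + Harman is a theorem-pattern, not a sieve lower
bound.
- Literature.Barriers.Parity.LargeSieveLevelHalf: APPLIES to any large-sieve/automorphic-kernel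
proof of ranks 2–3 (level X^(1/2)·L is past Q = √N; GM's D X^(1/2) and DFI95 Prop. 1's (d/M)^(1/20)
are its root-sequence avatars); EVADED by design: DFI97/BC are counting/amplification inequalities
nontrivial at M = N with arbitrary coefficients — the barrier file's own BFI quote names
'dispersion, Fourier analysis and Kloosterman sums' as the way past x^(1/2); whether the transplant
keeps the M = N property with entangled numerators is exactly rank 2 (honest: conjectural until
then).
- Literature.Barriers.Parity.FordMaynardMinimalTypeII: not engaged against us: the sieved sequence
is the MODULUS sequence r_k = a_k(X) − ρ(k)X/k (positive density in k, divisor-bounded), Type-II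
width [exp((log X)^(2/3)), X^(1/3)] supplied by TypeIIPolylog; the glue is FM's continuity point (½,
0⁺, ⅓) for bounded sequences (Thm 2.5); no lower

Novelty grade: new-combination — ROUTE REVIEW rreview-0815T18-23 (full text: evidence GF_route_review.md on this route). STATE rev 0, not in tree; needs_repair glue.extra-hypothesis x3 = frame items 0870/0873/0874 (+Assembly 0875) NOT attached; fix: route edit --add-items by signature (as CyclotomicTower/IsogenyRedei). ELAB: all 10 (refuter refuter-rreview-0815T18-23-0, 2026-08-15T19:22:46Z; prior: DukeFriedlanderIwaniec1997, arXiv:1502.00769, arXiv:1811.08672, DukeFriedlanderIwaniec1995, arXiv:2505.00493, route-Parity-PolynomialMobius (frame 0870/0873/0874/0875 verbatim), route-Parity-KloostermanFractions (retired; items 6765..6773 verbatim))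

History (route lifecycle, newest last):
- 2026-08-16T02:19:14Z · AUTO-CRUX: 1 conjecture-grade item(s) promoted to crux (QuadraticMobiusTail) — refuter vetting / tiering apply (operator:999:1362873)
- 2026-08-16T04:13:26Z · AUTO-CRUX (backfill): PolyMobiusTail — hypotheses of the deciding theorem that nothing in the route derives are cruxes (operator:999:1085951)
- 2026-08-24T20:59:43Z · DORMANT — reconciler: no traction for 7.1 d (last activity item-evidence-added at 2026-08-17T18:46:52Z); parked, not closed — `ledger route dormant route-Parity-GaussianF (operator:999:2639484)

sub-problem: BatemanHorn · status: dormant · opened planner-plancard-Parity-BatemanHorn-gaussian--e1a3bbd6-g2-0 2026-08-15T18:51:26Z · rev 4 · ledger route-Parity-GaussianFractions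
GENERATED by the gate from the ledger (D-0016/17). Provers cite these decls: `theorem foo : Summit.Parity.BatemanHorn.Theses.GaussianFractions.<Decl> := …` in Summits/Parity/BatemanHorn/Theorems/<Name>.lean.
-/

namespace Summit.Parity.BatemanHorn.Theses.GaussianFractions

open scoped BigOperators Topology Manifold Classical MeasureTheory ProbabilityTheory Matrix InnerProductSpace ComplexConjugate ContinuousMap
open Filter Set Function TopologicalSpace MeasureTheory

attribute [summit_statement] _root_.BatemanHorn

/-- item stmt-Parity-0870 · crux (kind.auto-crux: conjecture-grade) · rank 0 · open · by planner
why it might fail: = BatemanHorn in Λ-form modulo theorem-grade glue (Bombieri's indeterminacy: no Type-I level < 1 decides it); false iff BH fails for some system — which happens verbatim over 𝔽_q[u] for inseparable f (Conrad–Conrad–Gross); this route reaches one slice only.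
sources: BombieriAsymptoticSieve1976, arXiv:2008.09905, Literature.Barriers.Parity.FunctionFieldMobiusBias, Literature.Barriers.Parity.FordFixedLevelBarrier
[crux] X_PM, the Möbius tail: for every Bateman–Horn system f = (f_1..f_k) there is η ∈ (0,1) with
∑_{n≤x} ∑_{d_i | f_i(n), d_1⋯d_k > x^{1−η}} ∏_i μ(d_i) log d_i = o(x). Since ∏Λ(f_i(n)) = (−1)^k
∑_{d_i|f_i(n)} ∏ μ(d_i) log d_i and the complementary range d_1⋯d_k ≤ x^{1−η} is Type-I
(TypeIMainTerm), this is BatemanHorn minus theorem-grade glue. k = 1 reading: Möbius randomness of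
the large cofactor f(n)/e along the roots of f mod e, e ≤ x^{deg f − 1 + η}. Open (parity). Sources:
BombieriAsymptoticSieve1976 (indeterminacy), Entin2016 / SawinShusterman2018 (F_q[T] analogues are
theorems), BrowningSofosTeravainen2022 (true for 100% of f). -/
@[route_item "route-Parity-GaussianFractions", crux]
def PolyMobiusTail : Prop :=
  ∀ (k : ℕ) (f : Fin k → Polynomial ℤ), Literature.NumberTheory.Sieve.IsBatemanHornSystem f → ∃ η : ℝ, 0 < η ∧ η < 1 ∧ (fun x : ℕ => ∑ n ∈ Finset.Icc 1 x, ∑ d ∈ Fintype.piFinset (fun i => (((f i).eval (n : ℤ)).toNat).divisors), if (x : ℝ) ^ (1 - η) < ∏ i, (d i : ℝ) then ∏ i, ((ArithmeticFunction.moebius (d i) : ℝ) * Real.log (d i)) else 0) =o[Filter.atTop] fun x : ℕ => (x : ℝ)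

/-- item stmt-Parity-12214 · crux · rank 2 · open · by planner
why it might fail: The numerator is entangled with BOTH variables (h(ν_r − ν_p)p̄/r): DFI97/BC need a free numerator (tree fact DukeFriedlanderIwaniec1997_bilinearKloostermanFractions has fixed k), graph-supported numerators can kill all cancellation (a_m = m gives e(1/n)), and the ℤ[i] lattice count may lose R^(1/2).
sources: DukeFriedlanderIwaniec1997, BettinChandee2018, FouvryRadziwill2022, arXiv:2604.25177, doi:10.1007/s00013-021-01623-y, DukeFriedlanderIwaniec1995
[crux] ENGINE (card K1, typed over ℤ; re-wants stmt-Parity-6765). ∃ δ > 0: for X ≥ X₀, K ∈ [X^{1−δ},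
X^{1+δ}], P ∈ [X^{1/2−δ}, X^{1/2+δ}], K ≤ K' ≤ 2K, 0 ≤ T ≤ X, 1 ≤ t ≤ X^δ, 0 < |h| ≤ X^δ: Σ_{p ∈
(P,2P] prime} Σ_{a mod p, a² ≡ −1} | Σ_{r : t ∣ r, K < pr ≤ K'} Σ_{N mod pr : N² ≡ −1 (pr), N ≡ a
(p)} e(h(N − T)/(pr)) | ≤ K·X^{−δ} (trivial ≍ K/(t log P)). By CRT and reciprocity the phase is
e(hν_p r̄/p)·e(hν_r p̄/r) up to the smooth twist e(−hT/(pr)): a bilinear form in Kloosterman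
FRACTIONS with root numerators, outer variable = Gaussian prime π (p = Nπ, a = ι_π(i)), inner
variable = primitive Gaussian integer of norm r, |·| outside = arbitrary coefficients on π — the
DFI-1997/Bettin–Chandee shape at the balanced point r ≍ K/P ≍ P. Implies RootLevelBeyondHalf
(support FractionsToTypeI, Vaaler; coupling δ_RLBH ≤ δ/3). [difficulty: open-problem] -/
@[route_item "route-Parity-GaussianFractions"]
def RootFractionsBound : Prop :=
  ∃ δ : ℝ, 0 < δ ∧ ∃ X₀ : ℝ, ∀ X K K' P T : ℝ, ∀ t : ℕ, ∀ h : ℤ, X₀ ≤ X → X ^ (1 - δ) ≤ K → K ≤ X ^ (1 + δ) → K ≤ K' → K' ≤ 2 * K → X ^ (1 / 2 - δ) ≤ P → P ≤ X ^ (1 / 2 + δ) → 0 ≤ T → T ≤ X → 1 ≤ t → (t : ℝ) ≤ X ^ δ → h ≠ 0 → (h.natAbs : ℝ) ≤ X ^ δ → ∑ p ∈ (Finset.Ioc ⌊P⌋₊ ⌊2 * P⌋₊).filter Nat.Prime, ∑ a ∈ (Finset.range p).filter (fun a : ℕ => p ∣ a ^ 2 + 1), ‖∑ r ∈ (Finset.Icc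 1 ⌊2 * K⌋₊).filter (fun r : ℕ => t ∣ r ∧ K < (p : ℝ) * r ∧ (p : ℝ) * r ≤ K'), ∑ N ∈ (Finset.range (p * r)).filter (fun N : ℕ => p * r ∣ N ^ 2 + 1 ∧ N ≡ a [MOD p]), Complex.exp (2 * ↑Real.pi * Complex.I * ((h : ℂ) * ((N : ℂ) - (T : ℂ)) / ((p : ℂ) * (r : ℂ))))‖ ≤ K * X ^ (-δ)

/-- item stmt-Parity-12215 · crux · rank 3 · open · by planner
why it might fail: n²+1 analogue of 'primes to prime moduli beyond √x with fixed residue' (open; BFI reach x^(1/2+o(1)) with |·|); dlBD/GM stop at X^(1/2−o(1)) and by Vaughan it contains Merikoski's Type-I₂ at M = N = √P, 'open even for D₂ = 1'; a power saving may simply be false at P = X^(1/2+δ).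
sources: arXiv:2505.00493, Merikoski2022, DeshouillersIwaniec1982, BombieriFriedlanderIwaniecActa1986, FordMaynard2024PrimeSieves, DukeFriedlanderIwaniec1995
[crux] INTERFACE (card C3 of unimodular-mobius-gm-continuity with power room, signed over primes;
re-wants stmt-Parity-6766). ∃ δ > 0: for X ≥ X₀, K ∈ [X^{1−δ}, X^{1+δ}], K ≤ K' ≤ 2K, P ∈
[X^{1/2−δ}, X^{1/2+δ}], P ≤ P' ≤ 2P, 1 ≤ t ≤ X^δ: | Σ_{p ∈ (P,P'] prime} Σ_{k ∈ (K,K'], pt ∣ k} (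
#{1 ≤ ℓ ≤ X : k ∣ ℓ²+1} − X ρ(k)/k ) | ≤ X^{1−δ}, ρ = polyRootCountMod(X²+1) (trivial ≍ X/log X).
Signed level X^{1/2+δ} for the small-root sequence over moduli with a marked prime ≈ √K — the input
the Harman glue needs for the balanced semiprimes of the window. Print stops at |·|-divisor ≤
X^{1/2−o(1)}; refuter numerics (kit j000211/j000220, X ≤ 10⁷): square-root cancellation, no plateau.
[deps: RootFractionsBound] [difficulty: open-problem] -/
@[route_item "route-Parity-GaussianFractions"]
def RootLevelBeyondHalf : Prop :=
  ∃ δ : ℝ, 0 < δ ∧ ∃ X₀ : ℝ, ∀ X K K' P P' : ℝ, ∀ t : ℕ, X₀ ≤ X → X ^ (1 - δ) ≤ K → K ≤ X ^ (1 + δ) → K ≤ K' → K' ≤ 2 * K → X ^ (1 / 2 - δ) ≤ P → P ≤ X ^ (1 / 2 + δ) → P ≤ P' → P' ≤ 2 * P → 1 ≤ t → (t : ℝ) ≤ X ^ δ → abs (∑ p ∈ (Finset.Ioc ⌊P⌋₊ ⌊P'⌋₊).filter Nat.Prime, ∑ k ∈ (Finset.Ioc ⌊K⌋₊ ⌊K'⌋₊).filter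 (fun k : ℕ => p * t ∣ k), (((((Finset.Icc 1 ⌊X⌋₊).filter (fun ℓ : ℕ => k ∣ ℓ ^ 2 + 1)).card : ℕ) : ℝ) - X * (Literature.NumberTheory.Sieve.polyRootCountMod ![(Polynomial.X ^ 2 + 1 : Polynomial ℤ)] k : ℝ) / k)) ≤ X ^ (1 - δ)

/-- item stmt-Parity-12216 · crux · rank 4 · open · by planner
why it might fail: GM absorb the modulus average by a POINTWISE divisor bound (their ≺≺ hides exp(O(log X/log log X))); polylog losses need divisor sums on average inside the automorphic-kernel count, uniformly for N as small as exp((log X)^(2/3)) — may fail structurally.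
sources: arXiv:2505.00493, Merikoski2022, DukeFriedlanderIwaniec1995
[crux] Grimmelt–Merikoski's Type II (arXiv:2505.00493 Thm 1.5, h = a = 1; tree fact
`grimmeltMerikoski2025_thm15`) with POLYLOG losses down to tiny N (re-wants stmt-Parity-6767): ∀ A,
C > 0 ∃ B, X₀: for X ≥ X₀, K ∈ [X(log X)^{−C}, X(log X)^{C}], exp((log X)^{2/3}) ≤ N ≤ X^{1/3}(log
X)^{−B}, MN = K, real 1-bounded α, β supported on squarefrees: | Σ_{m ~ M} Σ_{n ~ N} α_m β_n ( #{ℓ ≤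
X : mn ∣ ℓ²+1} − Xρ(mn)/(mn) ) | ≤ X(log X)^{−A}. GM give ≺≺ M^{1/2}X^{1/2} + M^{1/4}NX^{1/2}(1 +
X/(M^{1/2}N²))^θ, saving min(N^{1/2}, (X/N³)^c) up to X^{o(1)}; the crux is the loss (log X)^{O(1)}
(deltas vs print: polylog loss, MN < X sharp, N down to exp((log X)^{2/3}) — a load-bearing floor: β
= δ_{n₀} gives ≍ K/N). [difficulty: L] -/
@[route_item "route-Parity-GaussianFractions"]
def TypeIIPolylog : Prop :=
  ∀ A : ℝ, 0 < A → ∀ C : ℝ, 0 < C → ∃ B : ℝ, ∃ X₀ : ℝ, ∀ X K M N : ℝ, ∀ α β : ℕ → ℝ, X₀ ≤ X → X / Real.log X ^ C ≤ K → K ≤ X * Real.log X ^ C → Real.exp (Real.log X ^ (2 / 3 : ℝ)) ≤ N → N ≤ X ^ (1 / 3 : ℝ) / Real.log X ^ B → M * N = K → (∀ m, abs (α m) ≤ 1) → (∀ n, abs (β n) ≤ 1) → (∀ m, ¬Squarefree m → α m = 0) → (∀ n, ¬Squarefree n → β n = 0) → abs (∑ m ∈ Finset.Ioc ⌊M⌋₊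 ⌊2 * M⌋₊, ∑ n ∈ Finset.Ioc ⌊N⌋₊ ⌊2 * N⌋₊, α m * β n * (((((Finset.Icc 1 ⌊X⌋₊).filter (fun ℓ : ℕ => m * n ∣ ℓ ^ 2 + 1)).card : ℕ) : ℝ) - X * (Literature.NumberTheory.Sieve.polyRootCountMod ![(Polynomial.X ^ 2 + 1 : Polynomial ℤ)] (m * n) : ℝ) / ((m : ℝ) * n))) ≤ X / Real.log X ^ A

/-- item stmt-Parity-12217 · crux · rank 5 · open · by planner
why it might fail: It is the parity atom: μ of the cofactor (n²+1)/e ≥ x(log x)^C along ρ(e) root classes with a (log x)^(2+δ) saving — Chowla-type for an irreducible quadratic; no Type-I/II mechanism exists (FordMaynardLowLevel, c = 1/2); only F_q[t] analogues are known.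
sources: SawinShusterman2022, Harman2007, FordMaynard2024PrimeSieves, Literature.Barriers.Parity.SelbergParityBarrier, Literature.Barriers.Parity.FordMaynardLowLevel
[crux] The parity atom of the slice, correctly quantified (re-wants stmt-Parity-6768; C, δ coupled
to nothing else, every admissible C leaves inner sums of length ≥ (log x)^C ρ(e); random model needs
C > 2 + 2δ): ∃ C ≥ 0, δ > 0, x₀: for x ≥ x₀, Σ_{e ≤ 2x(log x)^{−C}} | Σ_{n ≤ x, e ∣ n²+1, n²+1 >
e·x(log x)^C} μ((n²+1)/e) | ≤ x(log x)^{−1−δ} (trivial ≍ x log x). Covers every divisor d = (n²+1)/e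
above the log-window Y = x(log x)^C; its e = 1 term alone is Chowla for n²+1. Named, not attacked
here (cofactor-side routes: IsogenyRedei, SelmerPencil). [difficulty: open-problem] -/
@[route_item "route-Parity-GaussianFractions"]
def CofactorLog : Prop :=
  ∃ C : ℝ, 0 ≤ C ∧ ∃ δ : ℝ, 0 < δ ∧ ∃ x₀ : ℝ, ∀ x : ℝ, x₀ ≤ x → ∑ e ∈ Finset.Icc 1 ⌊2 * x / Real.log x ^ C⌋₊, abs (∑ n ∈ (Finset.Icc 1 ⌊x⌋₊).filter (fun n : ℕ => e ∣ n ^ 2 + 1 ∧ (e : ℝ) * x * Real.log x ^ C < (n : ℝ) ^ 2 + 1), (ArithmeticFunction.moebius ((n ^ 2 + 1) / e) : ℝ)) ≤ x / Real.log x ^ (1 + δ)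

/-- item stmt-Parity-13616 · crux (kind.auto-crux: conjecture-grade) · rank 9 · open · by planner
why it might fail: auto-crux — conjecture-grade statement (docstring avows it ('Conjecture')); it is open, so it may simply be false
sources: conjecture-registry
[support] The slice ENDPOINT, named (route review rreview-0815T18-23: "file SliceFromWindow's
consequent as a named item"): the k = 1, f = X²+1 slice of the frame X = PolyMobiusTail in
elementary form — ∃ η ∈ (0,1): Σ_{n≤x} Σ_{d ∣ n²+1, d > x^{1−η}} μ(d) log d = o(x). It is VERBATIM
the consequent of SliceFromWindow (so `SliceFromWindow ↔ (LogWindow → CofactorLog → RootMainTerms →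
QuadraticMobiusTail)` is `Iff.rfl`, checked), i.e. the one statement this route's slice chain
RootFractionsBound →(FractionsToTypeI) RootLevelBeyondHalf →(WindowFromTypeInfo) LogWindow
→(SliceFromWindow, with CofactorLog, RootMainTerms) actually delivers; with the Type-I main term at
level x^{1−η} (TypeIMainTerm at k = 1) it is Σ_{n≤x} Λ(n²+1) ∼ 𝔖·x, the Λ-form of Hardy–Littlewood
Conjecture E, hence open (parity: its e = 1 atom is Σ μ(n²+1) = o(x)); named so that
provers/refuters can close or kill the slice BY NAME and the census does not count the route as an
independent BatemanHorn line (its deciding power is the shared frame 0870/0873/0874). Not a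
hypothesis of `closes`. [deps: SliceFromWindow, LogWindow, CofactorLog, RootMainTerms] [difficulty:
open-problem] Sources: BatemanHorn1962, BombieriAsymptot -/
@[route_item "route-Parity-GaussianFractions"]
def QuadraticMobiusTail : Prop :=
  ∃ η : ℝ, 0 < η ∧ η < 1 ∧ (fun x : ℕ => ∑ n ∈ Finset.Icc 1 x, ∑ d ∈ Nat.divisors (n ^ 2 + 1), if (x : ℝ) ^ (1 - η) < ((d : ℕ) : ℝ) then (ArithmeticFunction.moebius d : ℝ) * Real.log (d : ℝ) else 0) =o[Filter.atTop] fun x : ℕ => (x : ℝ)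

/-- item stmt-Parity-0873 · support · rank 9 · closed · proved by Summit.Parity.BatemanHorn.Theorems.typeIMainTerm_proof (prover) · by planner
sources: BatemanHorn1962, BombieriAsymptoticSieve1976
[support] Type-I main term, theorem-grade: for every BH system f and η ∈ (0,1) there is C with
HasBatemanHornConst f C and (−1)^k ∑_{n≤x} ∑_{d_i | f_i(n), d_1⋯d_k ≤ x^{1−η}} ∏ μ(d_i) log d_i ~
C·x. Proof sketch: #{n ≤ x : d_i | f_i(n) ∀ i} = x ρ(d)/lcm(d) + O(ρ(d)) (period lcm(d) ≤ x^{1−η});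
the log-weighted singular series (−1)^k ∑_d ∏(μ(d_i) log d_i) ρ(d)/lcm(d) converges (ordered by the
cutoff) to the Bateman–Horn constant C(f) = ∏_p (1−1/p)^{−k}(1−ω(p)/p) by the prime ideal theorem
with error term in the splitting fields (Landau1903; BatemanHorn1962 §2; DavenportSchinzel1966; k =
1, f = X: −∑ μ(d) log d/d = 1). Named fact available:
Literature.NumberTheory.Sieve.exists_hasBatemanHornConst. Provable with substantial effort;
grounders may propose the needed Dedekind-zeta facts as Literature cites. -/
@[route_item "route-Parity-GaussianFractions", crux]
def TypeIMainTerm : Prop :=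
  ∀ (k : ℕ) (f : Fin k → Polynomial ℤ), Literature.NumberTheory.Sieve.IsBatemanHornSystem f → ∀ η : ℝ, 0 < η → η < 1 → ∃ C : ℝ, 0 < C ∧ Literature.NumberTheory.Sieve.HasBatemanHornConst f C ∧ Asymptotics.IsEquivalent Filter.atTop (fun x : ℕ => (-1 : ℝ) ^ k * ∑ n ∈ Finset.Icc 1 x, ∑ d ∈ Fintype.piFinset (fun i => (((f i).eval (n : ℤ)).toNat).divisors), if ∏ i, (d i : ℝ) ≤ (x : ℝ) ^ (1 - η) then ∏ i, ((ArithmeticFunction.moebius (d i) : ℝ) * Real.log (d i)) else 0) (fun x : ℕ => C * (x : ℝ))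

/-- `TypeIMainTerm` holds: proved by `Summit.Parity.BatemanHorn.Theorems.typeIMainTerm_proof`. -/
theorem TypeIMainTerm_holds : TypeIMainTerm := _root_.Summit.Parity.BatemanHorn.Theorems.typeIMainTerm_proof

/-- item stmt-Parity-0874 · support · rank 9 · closed · proved by Summit.Parity.BatemanHorn.LambdaToCount.lambdaToCount_proof (prover) · by planner
sources: BatemanHorn1962, IwaniecKowalski2004
[support] From Λ-weights to the count, theorem-grade: if ∑_{n≤x} ∏_i Λ(f_i(n)) ~ C·x with
HasBatemanHornConst f C then BatemanHornAsymptotic f (polyPrimeCount f x ~ C/(∏ deg f_i) · x/(log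
x)^k). Partial summation (Λ(f_i(n)) = log f_i(n) = deg f_i · log n + O(1) at prime values) plus
negligibility of proper prime-power values f_i(n) = p^a, a ≥ 2: O(x^{1/2+ε}) — trivial for deg ≤ 2,
Bombieri–Pila / Siegel integral points on y^a = f_i(x) for deg ≥ 3. C > 0 by
Literature.NumberTheory.Sieve.exists_hasBatemanHornConst. -/
@[route_item "route-Parity-GaussianFractions", crux]
def LambdaToCount : Prop :=
  ∀ (k : ℕ) (f : Fin k → Polynomial ℤ), Literature.NumberTheory.Sieve.IsBatemanHornSystem f → ∀ C : ℝ, 0 < C → Literature.NumberTheory.Sieve.HasBatemanHornConst f C → Asymptotics.IsEquivalent Filter.atTop (fun x : ℕ => ∑ n ∈ Finset.Icc 1 x, ∏ i, ArithmeticFunction.vonMangoldt (((f i).eval (n : ℤ)).toNat)) (fun x : ℕ => C * (x : ℝ)) → Literature.NumberTheory.Sieve.BatemanHornAsymptotic f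

/-- `LambdaToCount` holds: proved by `Summit.Parity.BatemanHorn.LambdaToCount.lambdaToCount_proof`. -/
theorem LambdaToCount_holds : LambdaToCount := _root_.Summit.Parity.BatemanHorn.LambdaToCount.lambdaToCount_proof

/-- item stmt-Parity-12218 · support · rank 9 · open · by planner
sources: arXiv:2505.00493, Merikoski2022, DeshouillersIwaniec1982, Hooley1976
[support] Type I BELOW the diagonal, sharp form of Grimmelt–Merikoski Thm 1.4 / Cor. 7.1 at h = a =
1 (re-wants stmt-Parity-6769; in tree as the smooth named fact
`grimmeltMerikoski2025_thm14_restricted` with the ℓ²+1 corollary `_restricted_one`; the printed K ≤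
X² range is refuted in tree, the restricted range covers K ≍ X): ∀ ε > 0 ∃ δ > 0, X₀: for X ≥ X₀, K
∈ [X^{1−δ}, X^{1+δ}], K ≤ K' ≤ 2K, 1 ≤ D ≤ X^{1/2−ε}: Σ_{d ≤ D} | Σ_{k ∈ (K,K'], d ∣ k} ( #{ℓ ≤ X :
k ∣ ℓ²+1} − Xρ(k)/k ) | ≤ X^{1−δ}. Known modulo unsmoothing (power room); NOT taken as a hypothesis,
so the route's cone has no unproved fact; used by the glue for the tiny Legendre moduli and marked
primes q ≤ X^{1/2−ε}. [difficulty: L] -/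
@[route_item "route-Parity-GaussianFractions"]
def TypeIBelowHalf : Prop :=
  ∀ ε : ℝ, 0 < ε → ∃ δ : ℝ, 0 < δ ∧ ∃ X₀ : ℝ, ∀ X K K' D : ℝ, X₀ ≤ X → X ^ (1 - δ) ≤ K → K ≤ X ^ (1 + δ) → K ≤ K' → K' ≤ 2 * K → 1 ≤ D → D ≤ X ^ (1 / 2 - ε) → ∑ d ∈ Finset.Icc 1 ⌊D⌋₊, abs (∑ k ∈ (Finset.Ioc ⌊K⌋₊ ⌊K'⌋₊).filter (fun k : ℕ => d ∣ k), (((((Finset.Icc 1 ⌊X⌋₊).filter (fun ℓ : ℕ => k ∣ ℓ ^ 2 + 1)).card : ℕ) : ℝ) - X * (Literature.NumberTheory.Sieve.polyRootCountMod ![(Polynomial.X ^ 2 + 1 : Polynomial ℤ)] k : ℝ) / k)) ≤ X ^ (1 - δ)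

/-- item stmt-Parity-12219 · support · rank 9 · open · by planner
sources: MontgomeryVaughan2007, BatemanHorn1962, Literature.NumberTheory.LFunctions.SiegelWalfiszMoebius_holds, Literature.NumberTheory.Sieve.tendsto_hardyLittlewoodE_partial_holds
[support] PNT(ℚ(i))-strength main-term inputs (re-wants stmt-Parity-6770), ρ =
polyRootCountMod(X²+1): ∀ A > 0 ∃ C: for y ≥ 2, |Σ_{d ≤ y} μ(d)ρ(d)/d| ≤ C(log y)^{−A} and |Σ_{d ≤
y} μ(d)ρ(d) log d/d + hardyLittlewoodEConst| ≤ C(log y)^{−A} (Σ_d μ(d)ρ(d)d^{−s} = G(s)/ζ(s), G(1) =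
hardyLittlewoodEConst, sign checked numerically: Σ → −1.37; μρ = μ·(1∗χ₋₄) on odd squarefrees, so
both follow from SiegelWalfiszMoebius_holds by the hyperbola method + Abel). Provable now
(laborious). [difficulty: provable-now] -/
@[route_item "route-Parity-GaussianFractions"]
def RootMainTerms : Prop :=
  ∀ A : ℝ, 0 < A → ∃ C : ℝ, ∀ y : ℝ, 2 ≤ y → abs (∑ d ∈ Finset.Icc 1 ⌊y⌋₊, (ArithmeticFunction.moebius d : ℝ) * (Literature.NumberTheory.Sieve.polyRootCountMod ![(Polynomial.X ^ 2 + 1 : Polynomial ℤ)] d : ℝ) / d) ≤ C / Real.log y ^ A ∧ abs (∑ d ∈ Finset.Icc 1 ⌊y⌋₊, (ArithmeticFunction.moebius d : ℝ) * (Literature.NumberTheory.Sieve.polyRootCountMod ![(Polynomial.X ^ 2 + 1 : Polynomial ℤ)] d : ℝ) * Real.log d / d + Literature.NumberTheory.Sieve.hardyLittlewoodEConst) ≤ C / Real.log y ^ A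

/-- item stmt-Parity-12220 · support · rank 9 · open · by planner
sources: FordMaynard2024PrimeSieves, arXiv:2505.00493, Harman2007, DukeFriedlanderIwaniec1995
[support] the LOG-window Möbius-on-moduli statement (re-wants stmt-Parity-6771), all heights,
sub-dyadic: ∀ C > 0 ∃ x₀: for x ≥ x₀, x(log x)^{−C} ≤ D ≤ x(log x)^{C}, D ≤ D' ≤ 2D: | Σ_{D<d≤D'}
μ(d)( #{n ≤ x : d ∣ n²+1} − xρ(d)/d ) | ≤ x(log x)^{−3/2}. Exponent 3/2 (not all A): the Harman
boundary slivers at X^{1/3±o(1)} cost x(log log x)²/(log x)², and 3/2 suffices for the slice because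
the window has O(log log x) sub-dyadic blocks against the weight log d. Output of
WindowFromTypeInfo; refuter numerics within 1σ of the random model for D ∈ [x/64, 8x], x ≤ 10⁶.
[difficulty: L] -/
@[route_item "route-Parity-GaussianFractions"]
def LogWindow : Prop :=
  ∀ C : ℝ, 0 < C → ∃ x₀ : ℝ, ∀ x D D' : ℝ, x₀ ≤ x → x / Real.log x ^ C ≤ D → D ≤ x * Real.log x ^ C → D ≤ D' → D' ≤ 2 * D → abs (∑ d ∈ Finset.Ioc ⌊D⌋₊ ⌊D'⌋₊, (ArithmeticFunction.moebius d : ℝ) * (((((Finset.Icc 1 ⌊x⌋₊).filter (fun n : ℕ => d ∣ n ^ 2 + 1)).card : ℕ) : ℝ) - x * (Literature.NumberTheory.Sieve.polyRootCountMod ![(Polynomial.X ^ 2 + 1 : Polynomial ℤ)] d : ℝ) / d)) ≤ x / Real.log x ^ (3 / 2 : ℝ)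

/-- item stmt-Parity-12221 · support · rank 9 · open · by planner
sources: Vaaler1985, MontgomeryVaughan2007, Hooley1976
[support] dual ⇒ primal (card K2; re-wants stmt-Parity-6772): RootFractionsBound →
RootLevelBeyondHalf. #{1 ≤ ℓ ≤ X : ℓ ≡ N (k)} − X/k = ψ(−N/k) − ψ((X−N)/k) exactly, Vaaler's
trigonometric majorant/minorant of the sawtooth at H = X^{2δ'} (zero-frequency error ≪ K/(tH log
P)), frequencies e(h(N−T)/k) for T ∈ {0, X} = the T-twist of the crux, split by the root a = N mod p
and the triangle inequality; sub-dyadic (P,P'] ⊂ (P,2P] is free by positivity of the (p,a)-summands;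
coupling δ' ≤ δ_RFB/3 (refuter g41-23). Vaaler/Erdős–Turán is not in tree (Literature gap).
[difficulty: L] -/
@[route_item "route-Parity-GaussianFractions"]
def FractionsToTypeI : Prop :=
  RootFractionsBound → RootLevelBeyondHalf

/-- item stmt-Parity-12222 · support · rank 9 · open · by planner
sources: Harman2007, FordMaynard2024PrimeSieves, DukeFriedlanderIwaniec1995, arXiv:2505.00493
[support] Harman-sieve glue on the log-window (card K4; re-wants stmt-Parity-6773):
RootLevelBeyondHalf → TypeIIPolylog → TypeIBelowHalf → LogWindow. Work with the DIFFERENCE sequence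
r_d(x) (no main terms to evaluate); decompose squarefree d ~ D ≍ x(log x)^{±C} by factorisation type
with z = exp((log X)^{2/3}): a sub-product in [z, X^{1/3}(log X)^{−B}] ⇒ Type II (coupling P⁻(m) ≥ q
removed on (log X)^{A+1} short q-ranges); else d = s·(≤ 3 primes > X^{1/3}(log)^{−B}), s < z: one
prime ⇒ Legendre to z truncated by Rankin at level z^L ≤ X^δ (TypeIBelowHalf) + Buchstab primes in
the Type-II range; two primes q ≤ m' ⇒ modulus s·e·q·m', q ∈ [X^{1/2−δ}, √(2x)(log x)^{C/2}]:
RootLevelBeyondHalf (signed over prime q, t = s·e ≤ X^δ, sub-dyadic ranges decouple m' ≥ q) or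
TypeIBelowHalf when q ≤ X^{1/2−ε}; three primes ≍ X^{1/3} ⇒ boundary sliver of mass ≪ x(log log
x)²/(log x)² < x(log x)^{−3/2}. Divisor-boundedness of a_k is what makes (½, 0⁺, ⅓) work
(FordMaynard2024PrimeSieves Thm 2.5). No Harman framework in tree: the route's largest Lean debt.
[difficulty: XL] -/
@[route_item "route-Parity-GaussianFractions"]
def WindowFromTypeInfo : Prop :=
  RootLevelBeyondHalf → TypeIIPolylog → TypeIBelowHalf → LogWindow

/-- item stmt-Parity-12223 · support · rank 9 · open · by planner
sources: BatemanHorn1962, BombieriAsymptoticSieve1976, MontgomeryVaughan2007, Hooley1976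
[support] NEW glue replacing the retired route's HLEFromLogWindow: LogWindow → CofactorLog →
RootMainTerms → (the k = 1, f = X²+1 instance of PolyMobiusTail, up to Fin 1 bookkeeping: ∃ η ∈
(0,1), Σ_{n≤x} Σ_{d ∣ n²+1, d > x^{1−η}} μ(d) log d = o(x)). Proof (η = 1/2, Y = x(log x)^C with C
from CofactorLog): Σ_{d∣m, d>w} μ(d) log d = −log m·Σ_{d∣m, d≤w} μ(d) − Σ_{d∣m, d>w} μ(d) log(m/d);
first piece o(x) by RootMainTerms at level x^{1/2}; in the second, d ∈ (x^{1/2}, x(log x)^{−2}] is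
trivial (errors ≪ x/log x, main terms by RootMainTerms), d ∈ [x(log x)^{−2}, Y] is LogWindow (Abel
in n against log(n²+1) over heights t ≥ x(log x)^{−3}, trivial O(t log t) below; Abel in d on O(log
log x) sub-dyadic blocks: O(x log log x (log x)^{−1/2})), d > Y is ≤ log x · CofactorLog = O(x(log
x)^{−δ}). [difficulty: M] -/
@[route_item "route-Parity-GaussianFractions"]
def SliceFromWindow : Prop :=
  LogWindow → CofactorLog → RootMainTerms → ∃ η : ℝ, 0 < η ∧ η < 1 ∧ (fun x : ℕ => ∑ n ∈ Finset.Icc 1 x, ∑ d ∈ Nat.divisors (n ^ 2 + 1), if (x : ℝ) ^ (1 - η) < ((d : ℕ) : ℝ) then (ArithmeticFunction.moebius d : ℝ) * Real.log (d : ℝ) else 0) =o[Filter.atTop] fun x : ℕ => (x : ℝ)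

/-- item stmt-Parity-13634 · support · rank 9 · open · by planner
[support] The Fin-1 bookkeeping link into the frame, typed (route review rreview-0815T18-23: "Fin 1
link itself untyped"): QuadraticMobiusTail → the literal (k = 1, f = ![X²+1]) instance of the
summand of X = PolyMobiusTail, i.e. ∃ η ∈ (0,1) with Σ_{n≤x} Σ_{d ∈ piFinset (i : Fin 1 ↦
divisors((X²+1)(n)))} [x^{1−η} < ∏_i d_i] ∏_i μ(d_i) log d_i = o(x). The consequent is
character-for-character what `PolyMobiusTail 1 ![X²+1] h` yields (checked: `h 1 _ hs` has this
type). Proof: Fintype.piFinset over Fin 1 ≃ Nat.divisors (n²+1) via d ↦ d 0 (Fin.prod_univ_one,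
Fintype.piFinset_univ / sum_equiv), and ((X²+1).eval n).toNat = n²+1 for n ≥ 1; same η.
Theorem-grade, provable now; it makes the slice chain … → LogWindow →(SliceFromWindow)
QuadraticMobiusTail →(this) X|_{(1, X²+1)} typed end to end. Not a hypothesis of `closes`. [deps:
QuadraticMobiusTail, PolyMobiusTail] [difficulty: provable-now] Sources: BatemanHorn1962, Mathlib
Fin.prod_univ_one / Fintype.piFinset. -/
@[route_item "route-Parity-GaussianFractions"]
def QuadraticFrameLink : Prop :=
  QuadraticMobiusTail → ∃ η : ℝ, 0 < η ∧ η < 1 ∧ (fun x : ℕ => ∑ n ∈ Finset.Icc 1 x, ∑ d ∈ Fintype.piFinset (fun i : Fin 1 => (((![(Polynomial.X ^ 2 + 1 : Polynomial ℤ)] i).eval (n : ℤ)).toNat).divisors), if (x : ℝ) ^ (1 - η) < ∏ i, (d i : ℝ) then ∏ i, ((ArithmeticFunction.moebius (d i) : ℝ) * Real.log (d i)) else 0) =o[Filter.atTop] fun x : ℕ => (x : ℝ)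

/-- item stmt-Parity-0875 · assembly · rank 1 · open · by planner
[assembly] PolyMobiusTail → TypeIMainTerm → LambdaToCount → BatemanHorn. Given k, f,
IsBatemanHornSystem f: take η from PolyMobiusTail; ∏_i Λ(f_i(n)) = (−1)^k ∑_{d ∈ ∏ divisors(f_i(n))}
∏_i μ(d_i) log d_i (Mathlib ArithmeticFunction.sum_moebius_mul_log_eq per coordinate,
Finset.prod_sum); split at ∏ d_i ≤ x^{1−η} (TypeIMainTerm: ~ C x) vs > x^{1−η} (tail: o(x));
IsEquivalent.add_isLittleO gives ∑∏Λ ~ C x (C ≠ 0 via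
Literature.NumberTheory.Sieve.exists_hasBatemanHornConst or directly); LambdaToCount concludes
BatemanHornAsymptotic f; BatemanHorn := Literature.NumberTheory.Sieve.BatemanHornConjecture is ∀ k
f, IsBatemanHornSystem f → BatemanHornAsymptotic f. Provable now (bookkeeping only). -/
@[route_item "route-Parity-GaussianFractions"]
def Assembly : Prop :=
  PolyMobiusTail → TypeIMainTerm → LambdaToCount → _root_.BatemanHorn

/-! D-0027 §2.1 — DECIDING THEOREM (planner-authored via `route open/edit --closes-file`; by planner-plancard-Parity-BatemanHorn-gaussian--e1a3bbd6-g2-0 2026-08-15T19:35:59Z):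
its hypotheses are this route's items and its conclusion the sub-problem Statement (glue_lint), and it elaborates with this file. -/

@[closes "route-Parity-GaussianFractions"] theorem closes (hTail : PolyMobiusTail) (hMain : TypeIMainTerm) (hCount : LambdaToCount) :
    _root_.BatemanHorn := by
  intro k f hf
  obtain ⟨η, hη0, hη1, hT⟩ := hTail k f hf
  obtain ⟨C, hC, hHas, hM⟩ := hMain k f hf η hη0 hη1
  refine hCount k f hf C hC hHas ?_
  -- Λ = -(μ · log) ∗ 1, coordinatewise
  have hΛ : ∀ m : ℕ, ArithmeticFunction.vonMangoldt m
      = -∑ e ∈ m.divisors, ((ArithmeticFunction.moebius e : ℝ) * Real.log e) := by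
    intro m
    have h := ArithmeticFunction.sum_moebius_mul_log_eq (n := m)
    simp only [ArithmeticFunction.log_apply] at h
    linarith
  -- step A: the product of the `Λ(fᵢ(n))` as a signed sum over divisor tuples
  have stepA : ∀ n : ℕ, (∏ i, ArithmeticFunction.vonMangoldt (((f i).eval (n : ℤ)).toNat))
      = (-1 : ℝ) ^ k * ∑ d ∈ Fintype.piFinset (fun i => (((f i).eval (n : ℤ)).toNat).divisors),
          ∏ i, ((ArithmeticFunction.moebius (d i) : ℝ) * Real.log (d i)) := by
    intro n
    simp_rw [hΛ]
    rw [Finset.prod_neg, Finset.card_univ, Fintype.card_fin, Finset.prod_univ_sum]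
  -- step B: the divisor sum splits into the Type-I range and the tail (complementary cut-offs)
  have stepB : ∀ x n : ℕ,
      (∑ d ∈ Fintype.piFinset (fun i => (((f i).eval (n : ℤ)).toNat).divisors),
          ∏ i, ((ArithmeticFunction.moebius (d i) : ℝ) * Real.log (d i)))
      = (∑ d ∈ Fintype.piFinset (fun i => (((f i).eval (n : ℤ)).toNat).divisors),
          if ∏ i, (d i : ℝ) ≤ (x : ℝ) ^ (1 - η) then
            ∏ i, ((ArithmeticFunction.moebius (d i) : ℝ) * Real.log (d i)) else 0)
        + (∑ d ∈ Fintype.piFinset (fun i => (((f i).eval (n : ℤ)).toNat).divisors),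
          if (x : ℝ) ^ (1 - η) < ∏ i, (d i : ℝ) then
            ∏ i, ((ArithmeticFunction.moebius (d i) : ℝ) * Real.log (d i)) else 0) := by
    intro x n
    rw [← Finset.sum_add_distrib]
    refine Finset.sum_congr rfl fun d _ => ?_
    by_cases h : ∏ i, (d i : ℝ) ≤ (x : ℝ) ^ (1 - η)
    · rw [if_pos h, if_neg (not_lt.mpr h), add_zero]
    · rw [if_neg h, if_pos (not_le.mp h), zero_add]
  -- the tail, times `(-1)^k`, is `o(C·x)`
  have hB := (hT.const_mul_left ((-1 : ℝ) ^ k)).trans_isBigO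
    (Asymptotics.isBigO_self_const_mul hC.ne' (fun x : ℕ => (x : ℝ)) Filter.atTop)
  refine (hM.add_isLittleO hB).congr_left (Filter.Eventually.of_forall fun x => ?_)
  simp only [Pi.add_apply]
  rw [← mul_add, ← Finset.sum_add_distrib, Finset.mul_sum]
  refine Finset.sum_congr rfl fun n _ => ?_
  rw [stepA n, stepB x n]

end Summit.Parity.BatemanHorn.Theses.GaussianFractions
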